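import Literature.Probability.Distributions.LogConcaveSequences
import HarnessLib

/-!
# Sequence lemmas for almost exchangeable measures (Borcea–Brändén–Liggett §6: Lemma 6.1, the `TP₂` step of Prop. 6.2)

J. Borcea, P. Brändén, T. M. Liggett, *Negative dependence and the geometry of polynomials*, J. Amer. Math. Soc.
22 (2009) 521–567 (arXiv:0707.2340, held `paper:arxiv-0707.2340`), §6. Verbatim:

> The Cauchy–Binet theorem […] asserts that `(AB)(𝐢,𝐣) = Σ_{𝐤, |𝐤|=|𝐢|=|𝐣|} A(𝐢,𝐤) B(𝐤,𝐣)` […]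
> **Lemma 6.1.** Let `{a_j}_{j=0}^n` and `{b_j}_{j=0}^n` be two LC sequences that satisfy (i) `{a_j + b_j}_{j=0}^n`
> is LC, and (ii) `a_j b_{j+1} ≥ a_{j+1} b_j` for all `0 ≤ j ≤ n-1`. If `ℓ < k` and `b_ℓ a_k > 0`, then `b_r a_r > 0`
> for all `ℓ ≤ r ≤ k`. *Proof.* Suppose that `a_r = 0` for some `ℓ ≤ r < k` and let `s` the largest such index.
> Assumption (ii) for `j = s` gives `b_s = 0`, hence `a_s + b_s = 0`. This contradicts the "no internal zeros" part
> of assumption (i) […]. Therefore `a_r > 0`, and a similar argument shows that `b_r > 0` as well. □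
> (Proof of Prop. 6.2) […] Let now `C = (a_0 a_1 … a_n ; b_0 b_1 … b_n)` […]. We claim that `C` is `TP₂`. Let
> `1 ≤ i < j ≤ n`. We need to prove that `a_i b_j ≥ b_i a_j`. Clearly, we may assume that `b_i a_j ≠ 0` and that
> `j - i ≥ 2`. By Lemma 6.1 we have `b_r a_r > 0` for `i ≤ r ≤ j` and thus `a_i/b_i ≥ a_{i+1}/b_{i+1} ≥ ⋯ ≥ a_j/b_j`
> by (ii), which shows that `C` is indeed `TP₂`. Let `E = (e_{i-j})_{i,j=0}^n`. By Theorem 3.8 we have that `E` is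
> `TP₂` and by the Cauchy–Binet formula so is `CE`. Now `CE = (Σ a_j e_j, Σ a_{j+1} e_j, … ; Σ b_j e_j, Σ b_{j+1} e_j, …)`,
> from which [`(Σ_j a_j e_j)(Σ_j b_{j+1} e_j) - (Σ_j a_{j+1} e_j)(Σ_j b_j e_j) ≥ 0`] follows. □

Here "LC" is BBL Def. 2.8: non-negative, log-concave, no internal zeros — the tree's `PF₂` predicate
`IsLogConcaveSeq` (`LogConcaveSequences.lean`, interval form `q(a)q(d) ≤ q(b)q(c)`).

## Contents (pure sequence facts; the measures are in `AlmostExchangeableRayleigh.lean`)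

* §1 **`TP₂` of the Toeplitz matrix of elementary symmetric values**: `k ↦ e_k(x)`, `x ≥ 0`, is `PF₂`
  (`isLogConcaveSeq_esymmVal`) — the `TP₂` case of "Theorem 3.8" ([ASW]) used in the proof of Prop. 6.2; obtained
  here from the tree's closure of `PF₂` under convolution (`e_k(x_1,…,x_m)` is the convolution of the Bernoulli
  profiles `(1, x_i)`), with the recursion `esymmVal_insert_succ`.
* §2 **Cauchy–Binet for `2 × 2` minors** of `C · E` with `C` a `2 × N` and `E` an `N × 2` matrix, as the sequence
  identity `(Σ a_k u_k)(Σ b_l v_l) - (Σ a_k v_k)(Σ b_l u_l) = Σ_{k<l} (a_k b_l - a_l b_k)(u_k v_l - u_l v_k)`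
  (`cauchyBinet_two`), and the resulting sign statement `cauchyBinet_two_nonneg`.
* §3 **Lemma 6.1** (`BorceaBrandenLiggett_lemma_6_1_left/_right`) and the `TP₂` claim for `C`
  (`tp2_of_lc`: `a_i b_j ≥ a_j b_i` for `i < j`).

## References

* [BorceaBrandenLiggett2007] J. Borcea, P. Brändén, T. M. Liggett, Negative dependence and the geometry of
  polynomials, J. Amer. Math. Soc. 22 (2009); arXiv:0707.2340 — §2.1 Def. 2.8, §6 Lemma 6.1, proof of Prop. 6.2,
  §3.5 Thm. 3.8 (c) ([ASW]).
* [Karlin1968] S. Karlin, Total positivity, Ch. 8 §1 (`PF₂` sequences and their convolutions).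
-/

noncomputable section

open Finset

namespace Literature.Probability.NegativeDependence

open Literature.Probability.Distributions

/-! ## §1 Elementary symmetric values of nonnegative reals form a `PF₂` sequence -/

section Esymm

variable {τ : Type*} [DecidableEq τ]

omit [DecidableEq τ] in
/-- `e_0 = 1` over any index set. [cite: BorceaBrandenLiggett2007, §6 proof of Prop. 6.2 (`e_j = e_j(x_1,…,x_{n-1})`)] -/
theorem esymmVal_zero (R : Finset τ) (x : τ → ℝ) : (∑ W ∈ R.powersetCard 0, ∏ i ∈ W, x i) = 1 := by
  rw [Finset.powersetCard_zero, Finset.sum_singleton, Finset.prod_empty]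

omit [DecidableEq τ] in
/-- `e_k(∅) = 0` for `k ≥ 1`. [cite: BorceaBrandenLiggett2007, §6 proof of Prop. 6.2] -/
theorem esymmVal_empty_succ (x : τ → ℝ) (k : ℕ) : (∑ W ∈ (∅ : Finset τ).powersetCard (k + 1), ∏ i ∈ W, x i) = 0 := by
  rw [Finset.powersetCard_eq_empty.2 (by simp), Finset.sum_empty]

omit [DecidableEq τ] in
/-- `e_k` vanishes above the number of variables. [cite: BorceaBrandenLiggett2007, §6 proof of Prop. 6.2] -/
theorem esymmVal_eq_zero_of_card_lt (R : Finset τ) (x : τ → ℝ) {k : ℕ} (hk : R.card < k) :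
    (∑ W ∈ R.powersetCard k, ∏ i ∈ W, x i) = 0 := by
  rw [Finset.powersetCard_eq_empty.2 hk, Finset.sum_empty]

/-- **The recursion `e_{k+1}(x, x_i) = e_{k+1}(x) + x_i e_k(x)`.** [cite: BorceaBrandenLiggett2007, §6 proof of
Prop. 6.2 (expansion of `g` along `z_n`)] -/
theorem esymmVal_insert_succ {R : Finset τ} {i : τ} (hi : i ∉ R) (x : τ → ℝ) (k : ℕ) :
    (∑ W ∈ (insert i R).powersetCard (k + 1), ∏ j ∈ W, x j) =
      (∑ W ∈ R.powersetCard (k + 1), ∏ j ∈ W, x j) + x i * ∑ W ∈ R.powersetCard k, ∏ j ∈ W, x j := by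
  rw [Finset.powersetCard_succ_insert hi, Finset.sum_union, Finset.sum_image, Finset.mul_sum]
  · congr 1
    refine Finset.sum_congr rfl fun W hW => ?_
    have hiW : i ∉ W := fun h' => hi ((Finset.mem_powersetCard.1 hW).1 h')
    rw [Finset.prod_insert hiW]
  · intro W hW W' hW' hWW'
    have hiW : i ∉ W := fun h' => hi ((Finset.mem_powersetCard.1 (Finset.mem_coe.1 hW)).1 h')
    have hiW' : i ∉ W' := fun h' => hi ((Finset.mem_powersetCard.1 (Finset.mem_coe.1 hW')).1 h')
    rw [← Finset.erase_insert hiW, hWW', Finset.erase_insert hiW']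
  · rw [Finset.disjoint_left]
    intro W hW hW'
    obtain ⟨W', hW'R, hWW'⟩ := Finset.mem_image.1 hW'
    have : i ∈ W := by rw [← hWW']; exact Finset.mem_insert_self i W'
    exact hi ((Finset.mem_powersetCard.1 hW).1 this)

/-- The same recursion as a convolution with the Bernoulli profile `(1, x_i, 0, …)`.
[cite: Karlin1968, Ch. 8 §1; BorceaBrandenLiggett2007, §6 proof of Prop. 6.2] -/
theorem esymmVal_insert_eq_seqConv {R : Finset τ} {i : τ} (hi : i ∉ R) (x : τ → ℝ) :
    (fun k => ∑ W ∈ (insert i R).powersetCard k, ∏ j ∈ W, x j) =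
      seqConv (fun k => ∑ W ∈ R.powersetCard k, ∏ j ∈ W, x j)
        (fun k => if k = 0 then 1 else if k = 1 then x i else 0) := by
  funext k
  cases k with
  | zero =>
    rw [esymmVal_zero, seqConv_def, Finset.sum_range_one, esymmVal_zero]
    simp
  | succ k =>
    rw [esymmVal_insert_succ hi, seqConv_def, Finset.sum_range_succ, Finset.sum_range_succ, Nat.sub_self,
      show k + 1 - k = 1 by omega]
    have hrest : ∑ j ∈ range k, (∑ W ∈ R.powersetCard j, ∏ l ∈ W, x l) *
        (if k + 1 - j = 0 then (1 : ℝ) else if k + 1 - j = 1 then x i else 0) = 0 :=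
      Finset.sum_eq_zero fun j hj => by
        have hj' := Finset.mem_range.1 hj
        rw [if_neg (by omega), if_neg (by omega), mul_zero]
    have h1 : (if (1 : ℕ) = 0 then (1 : ℝ) else if (1 : ℕ) = 1 then x i else 0) = x i := by simp
    have h0 : (if (0 : ℕ) = 0 then (1 : ℝ) else if (0 : ℕ) = 1 then x i else 0) = 1 := by simp
    rw [hrest, h1, h0]
    ring

/-- **`(e_k(x))_k` is `PF₂` for `x ≥ 0`**: `e_a(x) e_d(x) ≤ e_b(x) e_c(x)` for `a ≤ b ≤ d`, `a + d = b + c` — the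
`TP₂` property of the Toeplitz matrix `E = (e_{i-j})` ("By Theorem 3.8 we have that `E` is `TP₂`"), here by
closure of `PF₂` under convolution. [cite: BorceaBrandenLiggett2007, §6 proof of Prop. 6.2 and §3.5 Thm. 3.8 (c);
Karlin1968, Ch. 8 §1] -/
theorem isLogConcaveSeq_esymmVal (R : Finset τ) {x : τ → ℝ} (hx : ∀ i ∈ R, 0 ≤ x i) :
    IsLogConcaveSeq fun k => ∑ W ∈ R.powersetCard k, ∏ j ∈ W, x j := by
  induction R using Finset.induction_on with
  | empty =>
    have heq : (fun k => ∑ W ∈ (∅ : Finset τ).powersetCard k, ∏ j ∈ W, x j) =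
        fun k => if k = 0 then (1 : ℝ) else 0 := by
      funext k
      cases k with
      | zero => rw [esymmVal_zero, if_pos rfl]
      | succ k => rw [esymmVal_empty_succ, if_neg (Nat.succ_ne_zero k)]
    rw [heq]
    exact isLogConcaveSeq_delta zero_le_one
  | @insert i R hi ih =>
    rw [esymmVal_insert_eq_seqConv hi]
    refine isLogConcaveSeq_seqConv (ih fun j hj => hx j (Finset.mem_insert_of_mem hj))
      (isLogConcaveSeq_of_support_subset_zero_one (fun k => ?_) fun k hk => ?_)
    · split_ifs
      · exact zero_le_one
      · exact hx i (Finset.mem_insert_self i R)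
      · exact le_rfl
    · rw [if_neg (by omega), if_neg (by omega)]

end Esymm

/-! ## §2 Cauchy–Binet for `2 × 2` minors -/

section CauchyBinet

/-- **Cauchy–Binet for the `2 × 2` minors of `C E`** (`C` with rows `a, b`; `E` with columns `u, v`):
`(Σ_k a_k u_k)(Σ_l b_l v_l) - (Σ_k a_k v_k)(Σ_l b_l u_l) = Σ_{k<l} (a_k b_l - a_l b_k)(u_k v_l - u_l v_k)`.
[cite: BorceaBrandenLiggett2007, §6 (the Cauchy–Binet theorem, display before Lemma 6.1)] -/
theorem cauchyBinet_two (N : ℕ) (a b u v : ℕ → ℝ) :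
    (∑ k ∈ range N, a k * u k) * (∑ l ∈ range N, b l * v l) -
        (∑ k ∈ range N, a k * v k) * (∑ l ∈ range N, b l * u l) =
      ∑ k ∈ range N, ∑ l ∈ range N, if k < l then (a k * b l - a l * b k) * (u k * v l - u l * v k) else 0 := by
  -- `LHS = Σ_{k,l} a_k b_l (u_k v_l - v_k u_l)`
  have h1 : (∑ k ∈ range N, a k * u k) * (∑ l ∈ range N, b l * v l) -
      (∑ k ∈ range N, a k * v k) * (∑ l ∈ range N, b l * u l) =
      ∑ k ∈ range N, ∑ l ∈ range N, a k * b l * (u k * v l - v k * u l) := by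
    rw [Finset.sum_mul_sum, Finset.sum_mul_sum, ← Finset.sum_sub_distrib]
    refine Finset.sum_congr rfl fun k _ => ?_
    rw [← Finset.sum_sub_distrib]
    exact Finset.sum_congr rfl fun l _ => by ring
  rw [h1]
  -- split each summand according to `k < l`, `k = l`, `l < k`; the diagonal vanishes and the lower part is
  -- the upper part after swapping `k` and `l`
  have h2 : ∀ k ∈ range N, ∀ l ∈ range N, a k * b l * (u k * v l - v k * u l) =
      (if k < l then a k * b l * (u k * v l - v k * u l) else 0) +
        (if l < k then a k * b l * (u k * v l - v k * u l) else 0) := by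
    intro k _ l _
    rcases lt_trichotomy k l with hkl | rfl | hlk
    · rw [if_pos hkl, if_neg (lt_asymm hkl), add_zero]
    · simp only [lt_irrefl, if_false, add_zero]; ring
    · rw [if_neg (lt_asymm hlk), if_pos hlk, zero_add]
  rw [Finset.sum_congr rfl fun k hk => Finset.sum_congr rfl fun l hl => h2 k hk l hl]
  simp_rw [Finset.sum_add_distrib]
  rw [Finset.sum_comm (f := fun k l => if l < k then a k * b l * (u k * v l - v k * u l) else 0),
    ← Finset.sum_add_distrib]
  refine Finset.sum_congr rfl fun k _ => ?_
  rw [← Finset.sum_add_distrib]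
  refine Finset.sum_congr rfl fun l _ => ?_
  split_ifs <;> ring

/-- **`C E` is `TP₂` when `C` and `E` are**: if `a_k b_l ≥ a_l b_k` and `u_k v_l ≥ u_l v_k` for all `k < l` then
`(Σ a_k u_k)(Σ b_l v_l) ≥ (Σ a_k v_k)(Σ b_l u_l)`. [cite: BorceaBrandenLiggett2007, §6 proof of Prop. 6.2 ("by the
Cauchy–Binet formula so is `CE`")] -/
theorem cauchyBinet_two_nonneg (N : ℕ) {a b u v : ℕ → ℝ} (hC : ∀ k l, k < l → a l * b k ≤ a k * b l)
    (hE : ∀ k l, k < l → u l * v k ≤ u k * v l) :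
    (∑ k ∈ range N, a k * v k) * (∑ l ∈ range N, b l * u l) ≤
      (∑ k ∈ range N, a k * u k) * (∑ l ∈ range N, b l * v l) := by
  rw [← sub_nonneg, cauchyBinet_two]
  exact Finset.sum_nonneg fun k _ => Finset.sum_nonneg fun l _ => by
    split_ifs with hkl
    · exact mul_nonneg (sub_nonneg.2 (hC k l hkl)) (sub_nonneg.2 (hE k l hkl))
    · exact le_rfl

end CauchyBinet

/-! ## §3 Lemma 6.1 and the `TP₂` property of `C = (a ; b)` -/

section Lemma61

/-- **Borcea–Brändén–Liggett, Lemma 6.1 (the `a`-half)**: with `a, b ≥ 0`, `a + b` LC (no internal zeros) and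
(ii) `a_j b_{j+1} ≥ a_{j+1} b_j`, if `ℓ < k` and `b_ℓ a_k > 0` then `a_r > 0` for `ℓ ≤ r ≤ k` ("Suppose that
`a_r = 0` for some `ℓ ≤ r < k` and let `s` the largest such index. Assumption (ii) for `j = s` gives `b_s = 0`, hence
`a_s + b_s = 0`. This contradicts the 'no internal zeros' part of assumption (i)").
[cite: BorceaBrandenLiggett2007, §6 Lemma 6.1] -/
theorem BorceaBrandenLiggett_lemma_6_1_left {a b : ℕ → ℝ} (ha : ∀ k, 0 ≤ a k) (hb : ∀ k, 0 ≤ b k)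
    (hab : IsLogConcaveSeq fun k => a k + b k) (hii : ∀ j, a (j + 1) * b j ≤ a j * b (j + 1))
    {l k : ℕ} (hlk : l < k) (hl : 0 < b l) (hk : 0 < a k) {r : ℕ} (hlr : l ≤ r) (hrk : r ≤ k) : 0 < a r := by
  -- downward induction on `k - r`
  have key : ∀ d, d ≤ k - l → 0 < a (k - d) := by
    intro d
    induction d with
    | zero => intro _; rw [Nat.sub_zero]; exact hk
    | succ d ih =>
      intro hd
      have ih' := ih (by omega)
      by_contra hcon
      have h0 : a (k - (d + 1)) = 0 := le_antisymm (not_lt.1 hcon) (ha _)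
      -- (ii) at `s = k - (d+1)`: `a_{s+1} b_s ≤ a_s b_{s+1} = 0`, so `b_s = 0`
      have hs1 : k - (d + 1) + 1 = k - d := by omega
      have hbs : b (k - (d + 1)) = 0 := by
        have h' := hii (k - (d + 1))
        rw [hs1, h0, zero_mul] at h'
        rcases (hb (k - (d + 1))).eq_or_lt with h'' | h''
        · exact h''.symm
        · exact absurd h' (not_le.2 (mul_pos ih' h''))
      -- contradicts no internal zeros of `a + b` between `l` and `k`
      have hpos := hab.pos_of_mem_Icc (a := l) (b := k - (d + 1)) (d := k)
        (add_pos_of_nonneg_of_pos (ha l) hl) (add_pos_of_pos_of_nonneg hk (hb k)) (by omega) (by omega)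
      rw [h0, hbs, add_zero] at hpos
      exact lt_irrefl 0 hpos
  have hr : r = k - (k - r) := by omega
  rw [hr]
  exact key (k - r) (by omega)

/-- **Lemma 6.1 (the `b`-half)**: under the same hypotheses `b_r > 0` for `ℓ ≤ r ≤ k` ("a similar argument shows
that `b_r > 0` as well"). [cite: BorceaBrandenLiggett2007, §6 Lemma 6.1] -/
theorem BorceaBrandenLiggett_lemma_6_1_right {a b : ℕ → ℝ} (ha : ∀ k, 0 ≤ a k) (hb : ∀ k, 0 ≤ b k)
    (hab : IsLogConcaveSeq fun k => a k + b k) (hii : ∀ j, a (j + 1) * b j ≤ a j * b (j + 1))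
    {l k : ℕ} (_hlk : l < k) (hl : 0 < b l) (hk : 0 < a k) {r : ℕ} (hlr : l ≤ r) (hrk : r ≤ k) : 0 < b r := by
  -- upward induction on `r - l`
  obtain ⟨d, rfl⟩ : ∃ d, r = l + d := ⟨r - l, by omega⟩
  have key : ∀ d, l + d ≤ k → 0 < b (l + d) := by
    intro d
    induction d with
    | zero => intro _; rw [Nat.add_zero]; exact hl
    | succ d ih =>
      intro hd
      have ih' := ih (by omega)
      by_contra hcon
      have h0 : b (l + (d + 1)) = 0 := le_antisymm (not_lt.1 hcon) (hb _)
      -- (ii) at `j = l + d`: `a_{j+1} b_j ≤ a_j b_{j+1} = 0`, so `a_{j+1} = 0`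
      have has : a (l + d + 1) = 0 := by
        have h' := hii (l + d)
        rw [show l + d + 1 = l + (d + 1) by omega, h0, mul_zero] at h'
        rcases (ha (l + (d + 1))).eq_or_lt with h'' | h''
        · exact h''.symm
        · exact absurd h' (not_le.2 (mul_pos h'' ih'))
      have hpos := hab.pos_of_mem_Icc (a := l) (b := l + (d + 1)) (d := k)
        (add_pos_of_nonneg_of_pos (ha l) hl) (add_pos_of_pos_of_nonneg hk (hb k)) (by omega) hd
      rw [h0, show l + (d + 1) = l + d + 1 by omega, has, add_zero] at hpos
      exact lt_irrefl 0 hpos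
  exact key d hrk

/-- **"We claim that `C` is `TP₂`"**: under the hypotheses of Lemma 6.1, `a_i b_j ≥ a_j b_i` for all `i < j`
("Clearly, we may assume that `b_i a_j ≠ 0` […]. By Lemma 6.1 we have `b_r a_r > 0` for `i ≤ r ≤ j` and thus
`a_i/b_i ≥ a_{i+1}/b_{i+1} ≥ ⋯ ≥ a_j/b_j` by (ii)"). [cite: BorceaBrandenLiggett2007, §6 proof of Prop. 6.2] -/
theorem tp2_of_lc {a b : ℕ → ℝ} (ha : ∀ k, 0 ≤ a k) (hb : ∀ k, 0 ≤ b k)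
    (hab : IsLogConcaveSeq fun k => a k + b k) (hii : ∀ j, a (j + 1) * b j ≤ a j * b (j + 1))
    {i j : ℕ} (hij : i < j) : a j * b i ≤ a i * b j := by
  rcases (mul_nonneg (hb i) (ha j)).eq_or_lt with h0 | hpos
  · rw [mul_comm] at h0; rw [← h0]; exact mul_nonneg (ha i) (hb j)
  have hbi : 0 < b i := by
    rcases (hb i).eq_or_lt with h' | h'; · rw [← h', zero_mul] at hpos; exact absurd hpos (lt_irrefl 0)
    exact h'
  have haj : 0 < a j := by
    rcases (ha j).eq_or_lt with h' | h'; · rw [← h', mul_zero] at hpos; exact absurd hpos (lt_irrefl 0)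
    exact h'
  -- the chain `a_i b_r ≥ a_r b_i` for `i ≤ r ≤ j`, by induction on `r`
  have chain : ∀ d, i + d ≤ j → a (i + d) * b i ≤ a i * b (i + d) := by
    intro d
    induction d with
    | zero => intro _; rw [Nat.add_zero, mul_comm]
    | succ d ih =>
      intro hd
      have ih' := ih (by omega)
      have hr : 0 < a (i + d) := BorceaBrandenLiggett_lemma_6_1_left ha hb hab hii hij hbi haj (by omega) (by omega)
      have hr' : 0 < b (i + d) := BorceaBrandenLiggett_lemma_6_1_right ha hb hab hii hij hbi haj (by omega) (by omega)
      have step : a (i + d + 1) * b (i + d) ≤ a (i + d) * b (i + d + 1) := hii (i + d)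
      -- multiply `ih'` and `step`, cancel `a_{i+d} b_{i+d} > 0`
      rw [show i + (d + 1) = i + d + 1 by omega]
      have h3 : a (i + d + 1) * b i * (a (i + d) * b (i + d)) ≤ a i * b (i + d + 1) * (a (i + d) * b (i + d)) := by
        nlinarith [mul_le_mul step ih' (mul_nonneg (ha _) (hb _)) (mul_nonneg (ha _) (hb _)), ha i, hb i,
          ha (i + d + 1), hb (i + d + 1)]
      exact le_of_mul_le_mul_right h3 (mul_pos hr hr')
  have := chain (j - i) (by omega)
  rwa [show i + (j - i) = j by omega] at this

end Lemma61

end Literature.Probability.NegativeDependence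

end
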